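import Summits.PneNP.PneNP.Theses.PhaseTwins
import Literature.Computability.Complexity.FPRASTransfer
import Literature.Computability.Complexity.FPStringBricks
import Literature.Computability.Complexity.StockmeyerMachines
import Literature.Computability.Complexity.HardcoreInapproximability
import Literature.Computability.Complexity.BFNWCase1
import Literature.Computability.Complexity.ExpTimeCollapsesProofs
import Literature.Computability.Complexity.EquivalenceProblemsCollapseProofs
import Literature.Computability.Complexity.NPSubsetBPPCollapse
import Literature.Computability.Complexity.UniformDerandomizationEndgame
import Literature.Computability.Complexity.PolyHierarchy
import Literature.Computability.Complexity.ProbabilisticClassesProofs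

/-!
# Sketch — crux-ideate stmt-PneNP-2717 (NoFBPPApproxAboveUniqueness), ideator 2, round 1

First lemmas of the three idea cards (planner-cruxidea-stmt-PneNP-2717-2-0):

* card `split-exp-bpp-io-subexp`: `np_not_subset_bpp_of_split` (PROVED here) and the bridge
  `noFBPP_of_NP_not_subset_BPP` (proved modulo the padding lemma `hasFPRAS_of_padded`, sorried);
* card `blowup-physics-free-feeder`: `independencePolynomial_blowup` (statement; sorried);
* card `approximate-cocycle`: `IsApproxHardcoreCocycle` + `noFBPP_of_no_approx_cocycle` (statement; sorried).
-/

namespace Summit.PneNP.PneNP.Cruxes.NoFBPPApproxAboveUniqueness.Sketch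

open Literature.Computability.Complexity Literature.Probability.LatticeModels
open _root_.Computability Polynomial

/-! ### Card 1: the hardness-vs-randomness split of the crux's coin register -/

/-- **Split.** `EXP ≠ BPP` together with "for some `ε > 0`, `NP ⊄ io-DTIME(2^{⌈n^ε⌉})`" already gives
`NP ⊄ BPP` — by Ko/Zachos (`PH ⊆ BPP` under `NP ⊆ BPP`, proved in the tree), Meyer
(`EXP ⊆ P/poly → EXP = Σ₂ᵖ`, discharged in the tree) and the Babai–Fortnow–Nisan–Wigderson i.o.
simulation (`EXP ⊄ P/poly → BPP ⊆ io-DTIME(2^{n^ε})`, proved in the tree). -/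
theorem np_not_subset_bpp_of_split (h₁ : EXP ≠ BPP)
    (h₂ : ∃ ε : ℝ, 0 < ε ∧ ¬ Nondeterministic.NP ⊆ io (DTIME fun n => 2 ^ ⌈(n : ℝ) ^ ε⌉₊)) :
    ¬ Nondeterministic.NP ⊆ BPP := by
  intro hNP
  obtain ⟨ε, hε, hio⟩ := h₂
  have hPH : PH ⊆ BPP := PH_subset_BPP_of_NP_subset_BPP hNP
  have hEXP : ¬ EXP ⊆ PPoly := by
    intro hsub
    have hSig : EXP = SigmaP 2 := EXP_eq_SigmaP_two_of_subset_PPoly_holds hsub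
    apply h₁
    apply Set.Subset.antisymm
    · rw [hSig]
      exact (SigmaP_subset_PH 2).trans hPH
    · exact BPP_subset_EXP
  exact hio (hNP.trans (BPP_subset_io_DTIME_of_not_EXP_subset_PPoly hEXP hε))

/-! #### Padding removal (brick algebra), verbatim from Disproof.lean §1 (disprover gen 1) -/

namespace PadRemoval

/-! ### Removing the padding slot in `FP` (brick algebra; no machine is written)

On the canonical query `w = ⟨⟨x, ⟨1⁰, ⟨1^{kη}, 1^{kδ}⟩⟩⟩, U⟩` the transformer `tF c r` rebuilds
`⟨⟨x, ⟨1^{r|x|}, ⟨1^{kη}, 1^{kδ}⟩⟩⟩, U ↾ L⟩` with `L = c(|x| + r|x| + kη + kδ)`; composing the padded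
transducer with it gives an unpadded one using a PREFIX of its coins. -/

variable (c r : Polynomial ℕ)

/-- `x` (first field of the first field). -/
noncomputable def xF : List Bool → List Bool := Brick.fstF ∘ Brick.fstF

/-- `⟨1^{kη}, 1^{kδ}⟩` (the record after the padding slot). -/
noncomputable def kkF : List Bool → List Bool := Brick.sndF ∘ Brick.sndF ∘ Brick.fstF

/-- `1^{r|x|}`. -/
noncomputable def mF : List Bool → List Bool := Plumb.polyFn r ∘ xF

/-- `x 1^{r|x|} 1^{kη} 1^{kδ}`, a string of length `|x| + r|x| + kη + kδ`. -/
noncomputable def sF : List Bool → List Bool :=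
  fun w => (xF w ++ mF r w) ++ (Brick.fstF (kkF w) ++ Brick.sndF (kkF w))

/-- The ruler `1^L`, `L = c(|x| + r|x| + kη + kδ)`. -/
noncomputable def rulerF : List Bool → List Bool := Plumb.polyFn c ∘ sF r

/-- The truncated coins `U ↾ L`. -/
noncomputable def uF : List Bool → List Bool := Plumb.takeFn ∘ fanoutFn (rulerF c r) Brick.sndF

/-- The query transformer. -/
noncomputable def tF : List Bool → List Bool :=
  fanoutFn (fanoutFn xF (fanoutFn (mF r) kkF)) (uF c r)

theorem xF_mem_FP : xF ∈ FP := comp_mem_FP Brick.fstF_mem_FP Brick.fstF_mem_FP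

theorem kkF_mem_FP : kkF ∈ FP :=
  comp_mem_FP Brick.sndF_mem_FP (comp_mem_FP Brick.sndF_mem_FP Brick.fstF_mem_FP)

theorem mF_mem_FP : mF r ∈ FP := comp_mem_FP (Plumb.polyFn_mem_FP r) xF_mem_FP

theorem sF_mem_FP : sF r ∈ FP :=
  append_mem_FP (append_mem_FP xF_mem_FP (mF_mem_FP r))
    (append_mem_FP (comp_mem_FP Brick.fstF_mem_FP kkF_mem_FP) (comp_mem_FP Brick.sndF_mem_FP kkF_mem_FP))

theorem rulerF_mem_FP : rulerF c r ∈ FP := comp_mem_FP (Plumb.polyFn_mem_FP c) (sF_mem_FP r)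

theorem uF_mem_FP : uF c r ∈ FP :=
  comp_mem_FP Plumb.takeFn_mem_FP (fanoutFn_mem_FP (rulerF_mem_FP c r) Brick.sndF_mem_FP)

/-- `tF c r ∈ FP`. -/
theorem tF_mem_FP : tF c r ∈ FP :=
  fanoutFn_mem_FP (fanoutFn_mem_FP xF_mem_FP (fanoutFn_mem_FP (mF_mem_FP r) kkF_mem_FP)) (uF_mem_FP c r)

/-- **Semantics of the transformer on canonical queries.** -/
theorem tF_countQuery (x u : List Bool) (kη kδ : ℕ) :
    tF c r (countQuery x 0 kη kδ u) =
      countQuery x (r.eval x.length) kη kδ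
        (u.take (c.eval (x.length + r.eval x.length + kη + kδ))) := by
  have hx : xF (countQuery x 0 kη kδ u) = x := by
    simp [xF, countQuery]
  have hkk : kkF (countQuery x 0 kη kδ u) = boolPair (unaryEncodeNat kη) (unaryEncodeNat kδ) := by
    simp [kkF, countQuery]
  have hm : mF r (countQuery x 0 kη kδ u) = unaryEncodeNat (r.eval x.length) := by
    simp [mF, hx, APTransfer.ones_eq_unary]
  have hs : (sF r (countQuery x 0 kη kδ u)).length = x.length + r.eval x.length + kη + kδ := by
    simp [sF, hx, hm, hkk, APTransfer.length_unary]
    omega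
  have hsnd : Brick.sndF (countQuery x 0 kη kδ u) = u := by
    simp [countQuery]
  have hu : uF c r (countQuery x 0 kη kδ u) =
      u.take (c.eval (x.length + r.eval x.length + kη + kδ)) := by
    simp only [uF, rulerF, Function.comp_apply, fanoutFn_apply, Plumb.polyFn_apply, hs, hsnd,
      Plumb.takeFn_boolPair, List.length_replicate]
  simp only [tF, fanoutFn_apply, hx, hm, hkk, hu]
  rfl

end PadRemoval

/-- **Padding lemma**: an FBPP approximator that insists on a unary padding slot `1^{r|x|}` yields one
with the slot frozen at `0`, i.e. `HasFPRAS` — PROVED by the disprover (`Disproof.hasFPRAS_of_hasFPRASPadded`). -/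
theorem hasFPRAS_of_padded (N : List Bool → ℕ)
    (h : ∃ F ∈ FP, ∃ c r : Polynomial ℕ, ∀ (x : List Bool) (kη kδ : ℕ), 0 < kη → 0 < kδ →
      uniformProb (c.eval (x.length + r.eval x.length + kη + kδ))
        {u | ¬ IsApproxCount kη (N x) (countEstimate F x (r.eval x.length) kη kδ u)} ≤ 1 / (kδ : ℝ)) :
    HasFPRAS N := by
  -- proof COPIED VERBATIM from the standing disprover's Disproof.lean §1 (`hasFPRAS_of_hasFPRASPadded`,
  -- refuter-cdisprove-stmt-PneNP-2717-0, gen 1), inlined here only because the farm had not yet built the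
  -- Disproof module for import at check time.
  obtain ⟨F, hF, c, r, hP⟩ := h
  refine ⟨F ∘ PadRemoval.tF c r, comp_mem_FP hF (PadRemoval.tF_mem_FP c r), c.comp (X + r),
    fun x kη kδ hkη hkδ => ?_⟩
  set L := c.eval (x.length + r.eval x.length + kη + kδ) with hLdef
  have hL : L ≤ (c.comp (X + r)).eval (x.length + kη + kδ) := by
    simp only [eval_comp, eval_add, eval_X, hLdef]
    apply TM2Iter.eval_mono
    have := TM2Iter.eval_mono r (show x.length ≤ x.length + kη + kδ by omega)
    omega
  have key : {U | ¬ IsApproxCount kη (N x) (countEstimate (F ∘ PadRemoval.tF c r) x 0 kη kδ U)} =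
      {U | U.take L ∈ {u | ¬ IsApproxCount kη (N x) (countEstimate F x (r.eval x.length) kη kδ u)}} := by
    ext U
    simp only [Set.mem_setOf_eq, countEstimate_def, Function.comp_apply, PadRemoval.tF_countQuery, hLdef]
  rw [key]
  exact APTransfer.uniformProb_take_le_of_le hL _ (hP x kη kδ hkη hkδ)

/-- **Bridge (one direction of "X is NP ⊄ BPP in costume").** From the Galanis–Štefankovič–Vigoda
named fact and `¬ NP ⊆ BPP`, the crux at the instance `(Δ, p, q) = (3, 5, 1)` (`λ = 5 > 4 = λ_c(3)`). -/
theorem noFBPP_of_NP_not_subset_BPP (hGSV : NP_eq_RP_of_hardcoreFPRAS)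
    (h : ¬ Nondeterministic.NP ⊆ BPP) :
    Summit.PneNP.PneNP.Theses.PhaseTwins.NoFBPPApproxAboveUniqueness := by
  refine ⟨3, 5, 1, le_rfl, Nat.one_pos, ?_, ?_⟩
  · norm_num
  · rintro ⟨F, hF, c, r, hFcr⟩
    apply h
    have hfpras : HasFPRAS (hardcoreCount 3 5 1) :=
      hasFPRAS_of_padded (hardcoreCount 3 5 1) ⟨F, hF, c, r, hFcr⟩
    have hthr : hardCoreThreshold 3 < ((5 : ℕ) : ℝ) / ((1 : ℕ) : ℝ) := by
      rw [hardCoreThreshold_three]; norm_num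
    have hNPRP : Nondeterministic.NP = RP := hGSV 3 5 1 le_rfl Nat.one_pos hthr hfpras
    rw [hNPRP]
    exact RP_subset_BPP_holds

/-- The two cards chained: the crux from two textbook conjectures and one named fact. -/
theorem noFBPP_of_split (hGSV : NP_eq_RP_of_hardcoreFPRAS) (h₁ : EXP ≠ BPP)
    (h₂ : ∃ ε : ℝ, 0 < ε ∧ ¬ Nondeterministic.NP ⊆ io (DTIME fun n => 2 ^ ⌈(n : ℝ) ^ ε⌉₊)) :
    Summit.PneNP.PneNP.Theses.PhaseTwins.NoFBPPApproxAboveUniqueness :=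
  noFBPP_of_NP_not_subset_BPP hGSV (np_not_subset_bpp_of_split h₁ h₂)

/-! ### Card 2: the blow-up identity (physics-free feeder at `λ = 1`) -/

/-- **Blow-up.** `G[K̄_r]`: replace every vertex by `r` twins, every edge by `K_{r,r}`
(`SimpleGraph.comap Prod.fst`). Its independent sets are the independent sets `J` of `G` decorated by a
non-empty subset of twins at each vertex of `J`, so `#IS(G[K̄_r]) = Z_G(2^r - 1)`; and
`maxDegree (G[K̄_r]) = r · maxDegree G`. -/
theorem independencePolynomial_blowup {n : ℕ} (G : SimpleGraph (Fin n)) [DecidableRel G.Adj] (r : ℕ) :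
    (independencePolynomial (SimpleGraph.comap Prod.fst G : SimpleGraph (Fin n × Fin r)) (1 : ℝ)) =
      independencePolynomial G ((2 : ℝ) ^ r - 1) := by
  sorry

/-! ### Card 3: approximate cocycles (truth-free form of the crux) -/

/-- Restriction of a `Fin n`-graph to a vertex subset, re-indexed by `Fin s.card` (increasing order). -/
def restrictFin {n : ℕ} (G : SimpleGraph (Fin n)) (s : Finset (Fin n)) : SimpleGraph (Fin s.card) :=
  SimpleGraph.comap (s.orderEmbOfFin rfl) G

/-- The estimate `F` returns (read by `countEstimate`, padding slot `0`) on the code of `G|s`. -/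
noncomputable def estAt (F : List Bool → List Bool) {n : ℕ} (G : SimpleGraph (Fin n))
    (s : Finset (Fin n)) (kη kδ : ℕ) (u : List Bool) : ℕ :=
  countEstimate F (encodingGraph.encode ⟨s.card, restrictFin G s⟩) 0 kη kδ u

/-- Coin budget of `F` (polynomial `c`) on the code of `G|s` at parameters `kη, kδ`. -/
noncomputable def coinLenAt (c : Polynomial ℕ) {n : ℕ} (G : SimpleGraph (Fin n)) (s : Finset (Fin n))
    (kη kδ : ℕ) : ℕ :=
  c.eval ((encodingGraph.encode ⟨s.card, restrictFin G s⟩).length + kη + kδ)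

open scoped Classical in
/-- **Approximate hard-core cocycle** at `(Δ, p, q)`: `F` (with coin polynomial `c`) respects, on every
graph of maximum degree `≤ Δ`, the vertex-deletion recurrence of `N = qⁿ Z_G(p/q)`,
`N(G|s) = q · N(G|s-v) + p · q^{deg_s v} · N(G|s-N[v])`, within relative error `3/kη`, for all but a
`3/kδ` fraction of the (concatenated) coin strings, and returns `1` on the empty graph. No reference
to the true count: failure is witnessed by a single `(G, s, v)` and three runs of `F`. -/
def IsApproxHardcoreCocycle (Δ p q : ℕ) (F : List Bool → List Bool) (c : Polynomial ℕ) : Prop :=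
  (∀ (kη kδ : ℕ), 1 < kη → 0 < kδ →
    uniformProb (coinLenAt c (⊥ : SimpleGraph (Fin 0)) ∅ kη kδ)
      {u | estAt F (⊥ : SimpleGraph (Fin 0)) ∅ kη kδ u ≠ 1} ≤ 1 / (kδ : ℝ)) ∧
  ∀ (n : ℕ) (G : SimpleGraph (Fin n)), G.maxDegree ≤ Δ →
    ∀ (s : Finset (Fin n)) (v : Fin n), v ∈ s → ∀ (kη kδ : ℕ), 0 < kη → 0 < kδ →
      uniformProb (coinLenAt c G s kη kδ + coinLenAt c G (s.erase v) kη kδ +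
          coinLenAt c G (s \ insert v (G.neighborFinset v)) kη kδ)
        {u | ¬ |(estAt F G s kη kδ (u.take (coinLenAt c G s kη kδ)) : ℝ) -
              ((q : ℝ) * estAt F G (s.erase v) kη kδ
                  ((u.drop (coinLenAt c G s kη kδ)).take (coinLenAt c G (s.erase v) kη kδ)) +
                (p : ℝ) * (q : ℝ) ^ (G.neighborFinset v ∩ s).card *
                  estAt F G (s \ insert v (G.neighborFinset v)) kη kδ
                    (u.drop (coinLenAt c G s kη kδ + coinLenAt c G (s.erase v) kη kδ)))| ≤
            3 / (kη : ℝ) * ((q : ℝ) * estAt F G (s.erase v) kη kδ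
                  ((u.drop (coinLenAt c G s kη kδ)).take (coinLenAt c G (s.erase v) kη kδ)) +
                (p : ℝ) * (q : ℝ) ^ (G.neighborFinset v ∩ s).card *
                  estAt F G (s \ insert v (G.neighborFinset v)) kη kδ
                    (u.drop (coinLenAt c G s kη kδ + coinLenAt c G (s.erase v) kη kδ)))}
        ≤ 3 / (kδ : ℝ)

/-- **Transfer (truth-free form ⇒ crux).** If no `FP` transducer is an approximate hard-core cocycle
at `(3, 5, 1)`, the crux holds (an FBPP approximator of `N` is automatically an approximate cocycle:
three `(1 + 1/kη)`-accurate values satisfy the exact recurrence up to relative error `≤ 3/kη`). -/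
theorem noFBPP_of_no_approx_cocycle
    (h : ∀ F ∈ FP, ∀ c : Polynomial ℕ, ¬ IsApproxHardcoreCocycle 3 5 1 F c) :
    Summit.PneNP.PneNP.Theses.PhaseTwins.NoFBPPApproxAboveUniqueness := by
  sorry

end Summit.PneNP.PneNP.Cruxes.NoFBPPApproxAboveUniqueness.Sketch
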